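import Mathlib
import HarnessLib
import HarnessLib.Audit
import Summits.QuantumAdvantage.QuantumAdvantage.Theorems.WalkThreeCharge
import Summits.QuantumAdvantage.QuantumAdvantage.Theorems.RigidityLaws
import Summits.QuantumAdvantage.AdviceFreeQNC0.ConstantBellsDense

/-!
# NamingDial, part B/4 (§2: the exchange law wins = Λ₁+Λ₂ and the endpoint-pair concentration witness) — support for item stmt-QuantumAdvantage-22907 (`Theses.DWalkThree.RingDenseResidualLt3`)

Cell decomp-qadv, seat lens-1 («grading / quantitative ladder»), generation 17 — land port of the node «NamingDial» (published under the cell's HOME/decomp-qadv-lens-1/g17/NamingDial.lean, record NODE-g17.md; RESIDUAL MODE on DWalkThree:22907). The node file with ONLY the namespace renamed `Theses.NamingDial → Theorems.NamingDial` and split at section boundaries into parts A–D (A, B, C independent; part D imports part A and alone imports the route file Theses.DWalkThree for the BY-NAME `closes`).  Prop-defs = the node's hardness predicate `ExclusionTwoThirds3` (part A, PROVED there), the counting functions `listing`/`wins` and explicit strategies (parts B, C), and the declared residual `NamingLift3` (part D).  Tree facts reused by name, not restated: `DWalk.predHardDWB3`, `two_pow_le_card_odd_class`, `card_odd_filter_le`,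 `three_mul_card_affine_mod_three`, `stake_eq_affine`, `dk3_eq_one_iff`, `Coset21.oddOneOutForm_holds`, `wtPrefix_zero`, `ConstBells.wtPrefix_self`, `Coset21.wtPrefix_succ`, `RigidityLaws.wtPrefix_one`, `Theorems.dWalkThree_ringFixedBellsSharp3`, `Theorems.dWalkThree_ringBShot3`.  No `sorry`, no new axioms, no instances, no notation.

THIS PART: `listing`, `wins`, `listing_mod`, `exchangeLaw`, `listing_le_wins`, `wins_le_two_max`, `endpointPair`, `classParity_endpointPair`, `endpointPair_win_iff`, `endpointPair_concentrated`, `endpointPair_predicts`, `endpointPair_listing_zero`, `endpointPair_listing_eq_wins`.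

NODE SYNOPSIS (all parts):

# NamingDial — lens-1 (grading / quantitative ladder) node, cell `decomp-qadv`, generation 17

TARGET (blocker, by name): `Theses.DWalkThree.RingDenseResidualLt3` (stmt-QuantumAdvantage-22907)
`= RingFixedBellsSharp3 → RingBShot3 → RingHardOdd 3`, both hypotheses PROVED in the tree, so the item is
`RingHardOdd 3` (T): Bob's polylog-degree `𝔽₃` strategies win the mod-3 ring game on at most `θ·2^{n-1}` odd inputs.

THE DIAL.  Grade a strategy by HOW MUCH IT MUST NAME.  By the tree's odd-one-out form T′
(`Coset21.oddOneOutForm_holds`) every strategy `y` wins on `u` iff `nae₀ y u ∧ wt u ≢ −c − oddOneOut y u (mod 3)`: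
winning IS excluding one value of the secret `W = |u| mod 3`, the excluded value being named by the REFEREE-assisted
colouring `u ↦ −c − oddOneOut y u` (computed from the hidden class parities).  The rungs, weakest player first:

* E1 DEFINABLE NAMING  — the player himself outputs a polylog-degree `𝔽₃`-colouring `g` and wins iff `g x ≠ D_k x`.
* E2 ONE BLIND BET      — one bell at a fixed cut, rung adaptively (`OneBellDWB3`, PROVED in tree).
* E3 FEW BLIND BETS     — `≤ N^{1/4}` ringing bells (`BShotDWB3`, PROVED in tree).
* E4 MANY BLIND BETS    — all polylog strategies = T.

LAWS PROVED IN THIS FILE (0 sorry):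

* L1 `exclusionTwoThirds3` (rung E1, NEW): no polylog `𝔽₃`-colouring EXCLUDES the stake `D_k` on more than
  `(2/3+ε)` of the odd class — from the tree's prediction law `DWalk.predHardDWB3` by the shift pigeonhole
  `{g ≠ D} = {g+1 = D} ⊔ {g+2 = D}`.  SHARP: `exclusion_sharp` — the constant colouring `1` (degree 0) excludes `D_k` on
  `≥ (2^N − 2)/3` odd inputs (`three_mul_card_dk3_eq_one_le`, the upper twin of the tree's odd-class equidistribution).
* L2 `exchangeLaw`: for EVERY strategy, `#wins_c(y) = Λ₁ + Λ₂`, `Λ_j = #{u : nae₀ ∧ wt u + c + oddOneOut ≡ j}` —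
  wins and correct "listings" of `W` are the same currency at rate ≤ 2 (`listing_le_wins`, `wins_le_two_max`).
* L3 `endpointPair_concentrated` (+ `endpointPair_win_iff`): the degree-0 strategy firing cuts `0` and `n` puts ALL its
  wins on ONE residue (`wt u + c + oddOneOut ≡ c + 2n`) and wins iff `c ≢ n ∧ n + W ≢ 0` (≈ 2/3 of inputs): the listing
  rate `max_j Λ_j / 2ⁿ` already reaches `2/3` at degree 0, so NO listing threshold `π < 2/3` holds and the factor-2
  exchange cannot carry a bound below `T` — the «ListingDial» door is CLOSED (instrument `g17/exp/listing.py`, n ≤ 8: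
  exchange-law violations 0; max listing 0.664 at Y = {0,n}; max win 0.75, 0.6875, 0.672 for n = 3‥8).
* L4 `promise_one` / `promise_two_wins`: give the player ONE value that `W` is NOT and the game collapses — on a promise
  class `{W ≡ r}` a constant single cut wins EVERY input (degree 0), and on `{W ≢ r₀}` the strategy «first cut of prefix
  class `−c−r₀` among the first `K`» wins every input whose class walk hits that class before `K` (all but a `2^{1-K}`
  fraction: `avoid_forces_prefix`).  The hardness of T is exactly the LAST trit: input partitions by the hidden class
  (σ-promise / monodromy classes, `g17/exp/fullclass.py`: the identity-monodromy FULL class is won by `tGuess` w.p. 1.000,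
  N = 4‥10) are classically trivial — the «PromiseDial» door is CLOSED.

NODE EQUATION (honest LADDER; no route requested):
  `RingDenseResidualLt3 ⟸ ExclusionTwoThirds3 [E1 · WEAKER · PROVED here] ∧ NamingLift3 [E1 → RingHardOdd 3 · ≡ T given E1 ·
  IDEA-NEEDED: a two-moduli correlation bound for MANY blind bets]` — `closes` below, by name.  The residual is the blocker
  itself; what this generation adds is the proved rung BELOW the one-bell law and two door-closing laws (L3, L4) with
  kernel witnesses, so that later lens-1 seats do not re-open the listing-threshold or promise-class dials.

WHY EACH PIECE IS STRICTLY WEAKER / EQUIVALENT.  E1 is a theorem (this file) while T is open (probe P1 `E1 → T` fails);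
informally E1 sits below E3 (a named exclusion `W ≠ E(u)` turns into a ≤ 1-ringing-bell strategy — the u-coordinate construction
is `promise_two_wins` with `r₀ :=` the named value); `NamingLift3` is T itself given E1 (declared, not hidden: `lift_of_target`).  WHY NOVEL relative to the other five lenses: no other node grades by the information the player
must NAME (exclusion vs blind bet), none has the exchange identity `wins = Λ₁ + Λ₂` or the promise-collapse law; lens-2
(BlindLoss/pointer readers), lens-3 (Quartic/Perceptron), lens-4 (Unity/Live), lens-5 (Grade/Corner/Restriction), lens-6
(Null/Slice/Orbit) grade strategies or inputs by algebraic shape, not by naming power.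

REPAIR CENSUS (doors tried this generation and why each is closed — evidence in `g17/NODE-g17.md`): degree / depth / prime
gradings (nested ⇒ LADDER, g14–g16); locality by partition (win-neutral scrambling, g15 law) and by domination
(`ringLocal_polylog_lt3` already PROVES the polylog-radius local law ⇒ residual ≡ T); listing threshold (L3 above);
law-shape dial on `wt u + oddOneOut` (a sure value ≠ −c IS near-perfect play ≡ ¬T); promise / monodromy classes (L4);
density-hurts (false: win-neutral gated triples); charge split (three-charge identity ⇒ similar subcases); XOR / direct
product (returns to the untyped (D3-core′)); (degree, sparsity) bi-grading (next rungs are items 27655 / PerfectDial).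
-/

namespace Summit.QuantumAdvantage.QuantumAdvantage.Theorems.NamingDial

set_option linter.dupNamespace false

open Classical
open Finset
open Summit.QuantumAdvantage.AdviceFreeQNC0
open Summit.QuantumAdvantage.AdviceFreeQNC0.Coset21
open Literature.Computability.MetaComplexity Literature.Computability.MetaComplexity.Smolensky

/-! ## §2  The exchange law `wins = Λ₁ + Λ₂` (every strategy) and the endpoint-pair concentration witness -/

variable {n : ℕ}

/-- `Λ_j(y, c)`: inputs on which the referee-assisted colouring lists `W` correctly at shift `j`, i.e.
`nae₀ y u ∧ wt u + c + oddOneOut y u ≡ j (mod 3)`. -/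
noncomputable def listing (n c : ℕ) (y : Fin (n + 1) → (Fin n → Bool) → Bool) (j : ℕ) : ℕ :=
  (univ.filter fun u : Fin n → Bool => nae₀ y u ∧ (wt u + c + oddOneOut y u) % 3 = j % 3).card

/-- number of inputs won at charge `c`. -/
noncomputable def wins (n c : ℕ) (y : Fin (n + 1) → (Fin n → Bool) → Bool) : ℕ :=
  (univ.filter fun u : Fin n → Bool => ringWinU c y u = true).card

/-- `Λ_j` depends on `j mod 3` only. -/
theorem listing_mod (n c : ℕ) (y : Fin (n + 1) → (Fin n → Bool) → Bool) (j : ℕ) :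
    listing n c y j = listing n c y (j % 3) := by
  unfold listing
  simp only [Nat.mod_mod]

/-- **L2 EXCHANGE LAW** (every `n, c, y`): `#wins = Λ₁ + Λ₂`. -/
theorem exchangeLaw (n c : ℕ) (y : Fin (n + 1) → (Fin n → Bool) → Bool) :
    wins n c y = listing n c y 1 + listing n c y 2 := by
  unfold wins listing
  have hdisj : Disjoint
      (univ.filter fun u : Fin n → Bool => nae₀ y u ∧ (wt u + c + oddOneOut y u) % 3 = 1 % 3)
      (univ.filter fun u : Fin n → Bool => nae₀ y u ∧ (wt u + c + oddOneOut y u) % 3 = 2 % 3) := by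
    rw [disjoint_filter]
    intro u _ h1 h2
    omega
  rw [← card_union_of_disjoint hdisj]
  congr 1
  ext u
  simp only [mem_filter, mem_union, mem_univ, true_and]
  rw [oddOneOutForm_holds n c y u]
  constructor
  · rintro ⟨hn, hne⟩
    have h12 : (wt u + c + oddOneOut y u) % 3 = 1 % 3 ∨ (wt u + c + oddOneOut y u) % 3 = 2 % 3 := by omega
    rcases h12 with h | h
    · exact Or.inl ⟨hn, h⟩
    · exact Or.inr ⟨hn, h⟩
  · rintro (⟨hn, h⟩ | ⟨hn, h⟩)
    · exact ⟨hn, by omega⟩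
    · exact ⟨hn, by omega⟩

/-- corollary: a listing never exceeds the win count (`L(π) ⇒ T(π)` is free). -/
theorem listing_le_wins (n c : ℕ) (y : Fin (n + 1) → (Fin n → Bool) → Bool) (j : ℕ) (hj : j % 3 ≠ 0) :
    listing n c y j ≤ wins n c y := by
  rw [listing_mod, exchangeLaw]
  have hj' : j % 3 = 1 ∨ j % 3 = 2 := by omega
  rcases hj' with h | h
  · rw [h]; exact Nat.le_add_right _ _
  · rw [h]; exact Nat.le_add_left _ _

/-- corollary: the better of the two listings carries at least half the wins (the factor-2 exchange rate). -/
theorem wins_le_two_max (n c : ℕ) (y : Fin (n + 1) → (Fin n → Bool) → Bool) :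
    wins n c y ≤ 2 * max (listing n c y 1) (listing n c y 2) := by
  rw [exchangeLaw]
  have h1 := le_max_left (listing n c y 1) (listing n c y 2)
  have h2 := le_max_right (listing n c y 1) (listing n c y 2)
  omega

-- Prefix-weight bookkeeping is the tree's: `AdviceFreeQNC0.wtPrefix_zero` (WindowLadderBlocks), `ConstBells.wtPrefix_self`
-- (ConstantBellsDense), `Coset21.wtPrefix_succ` (WalkQuotient), `RigidityLaws.wtPrefix_one` (RigidityLaws) — cited by name, not restated.

/-! ### The endpoint pair `Y = {0, n}` (degree 0): all wins on one residue, win rate ≈ 2/3 -/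

/-- the constant strategy firing exactly the cuts `0` and `n`. -/
def endpointPair (n : ℕ) : Fin (n + 1) → (Fin n → Bool) → Bool :=
  fun g _ => decide (g.val = 0 ∨ g.val = n)

/-- class parities of the endpoint pair: classes `0` (cut 0) and `n + wt u` (cut n). -/
theorem classParity_endpointPair (hn : 1 ≤ n) (u : Fin n → Bool) (b : ℕ) :
    classParity (endpointPair n) u b
      = ((if b % 3 = 0 then 1 else 0) + (if (n + wt u) % 3 = b % 3 then 1 else 0)) % 2 := by
  unfold classParity
  have hset : (univ.filter fun g : Fin (n + 1) =>
        endpointPair n g u = true ∧ (g.val + wtPrefix u g.val) % 3 = b % 3)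
      = (({0, Fin.last n} : Finset (Fin (n + 1))).filter
          fun g => (g.val + wtPrefix u g.val) % 3 = b % 3) := by
    ext g
    simp only [endpointPair, mem_filter, mem_univ, true_and, decide_eq_true_eq, mem_insert, mem_singleton,
      Fin.ext_iff, Fin.val_zero, Fin.val_last]
  have hne : (0 : Fin (n + 1)) ≠ Fin.last n := by
    intro h
    have := congrArg Fin.val h
    simp at this
    omega
  rw [hset, filter_insert, filter_singleton]
  simp only [Fin.val_zero, Fin.val_last, wtPrefix_zero, ConstBells.wtPrefix_self, Nat.zero_mod, zero_add]
  generalize b % 3 = β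
  by_cases h0 : 0 = β
  · subst h0
    by_cases h1 : (n + wt u) % 3 = 0
    · simp [h1, hne]
    · simp [h1]
  · have h0'' : ¬ β = 0 := fun h => h0 h.symm
    by_cases h1 : (n + wt u) % 3 = β
    · simp [h0, h0'', h1]
    · simp [h0, h0'', h1]

/-- **L3a — win set of the endpoint pair**: it wins iff `n + W ≢ 0` and `c ≢ n (mod 3)` (`(c + 2n) % 3 ≠ 0`);
in particular it NEVER wins when `c ≡ n`, and wins on `{W ≢ −n}` (≈ 2/3 of inputs) otherwise. -/
theorem endpointPair_win_iff (hn : 1 ≤ n) (c : ℕ) (u : Fin n → Bool) :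
    ringWinU c (endpointPair n) u = true ↔ ((n + wt u) % 3 ≠ 0 ∧ (c + 2 * n) % 3 ≠ 0) := by
  rw [oddOneOutForm_holds n c (endpointPair n) u]
  unfold nae₀ oddOneOut
  rw [classParity_endpointPair hn u 0, classParity_endpointPair hn u 1, classParity_endpointPair hn u 2]
  obtain ⟨r, hr, hr3⟩ : ∃ r, (n + wt u) % 3 = r ∧ r < 3 := ⟨_, rfl, Nat.mod_lt _ (by norm_num)⟩
  rw [hr]
  revert hr
  interval_cases r <;> norm_num <;> omega

/-- **L3b — CONCENTRATION**: whenever the endpoint pair wins, the referee-assisted residue is the SAME one,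
`wt u + c + oddOneOut ≡ c + 2n (mod 3)`; hence `min(Λ₁, Λ₂) = 0` and `max(Λ₁, Λ₂) = #wins ≈ (2/3)·2ⁿ` at degree 0 —
the listing rate is not bounded below `2/3` for ANY class of strategies containing the constants. -/
theorem endpointPair_concentrated (hn : 1 ≤ n) (c : ℕ) (u : Fin n → Bool)
    (hw : ringWinU c (endpointPair n) u = true) :
    (wt u + c + oddOneOut (endpointPair n) u) % 3 = (c + 2 * n) % 3 := by
  rw [oddOneOutForm_holds n c (endpointPair n) u] at hw
  unfold nae₀ at hw
  unfold oddOneOut at hw ⊢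
  rw [classParity_endpointPair hn u 0, classParity_endpointPair hn u 1, classParity_endpointPair hn u 2] at hw ⊢
  obtain ⟨r, hr, hr3⟩ : ∃ r, (n + wt u) % 3 = r ∧ r < 3 := ⟨_, rfl, Nat.mod_lt _ (by norm_num)⟩
  rw [hr] at hw ⊢
  revert hw hr
  interval_cases r <;> norm_num <;> omega

/-- **L3b′ — the hidden parities carry a full trit at degree 0**: on every input it wins (≈ 2/3 of them) the endpoint pair's
referee-assisted colouring PREDICTS the secret, `W ≡ 2n + 2·oddOneOut (mod 3)` — while no DEFINABLE colouring predicts `W`'s stake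
analogue on more than `1/3 + ε` (`DWalk.predHardDWB3`).  Assistance is informative about `W`, yet (`endpointPair_win_iff`) it does not lift
the win rate above `2/3`: information about `W` and winning are different currencies. -/
theorem endpointPair_predicts (hn : 1 ≤ n) (c : ℕ) (u : Fin n → Bool)
    (hw : ringWinU c (endpointPair n) u = true) :
    wt u % 3 = (2 * n + 2 * oddOneOut (endpointPair n) u) % 3 := by
  have h := endpointPair_concentrated hn c u hw
  omega

/-- **L3c — one listing of the endpoint pair is EMPTY** (`min(Λ₁,Λ₂) = 0`), for every `n ≥ 1` and every charge. -/
theorem endpointPair_listing_zero (hn : 1 ≤ n) (c : ℕ) :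
    listing n c (endpointPair n) 1 = 0 ∨ listing n c (endpointPair n) 2 = 0 := by
  have key : ∀ j : ℕ, j % 3 ≠ 0 → j % 3 ≠ (c + 2 * n) % 3 → listing n c (endpointPair n) j = 0 := by
    intro j hj0 hj
    unfold listing
    rw [card_eq_zero, filter_eq_empty_iff]
    intro u _ h
    rcases h with ⟨hnae, hres⟩
    have hwin : ringWinU c (endpointPair n) u = true := by
      rw [oddOneOutForm_holds n c (endpointPair n) u]
      exact ⟨hnae, by omega⟩
    have := endpointPair_concentrated hn c u hwin
    omega
  by_cases h1 : 1 % 3 = (c + 2 * n) % 3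
  · right; exact key 2 (by norm_num) (by omega)
  · left; exact key 1 (by norm_num) h1

/-- **L3d — and the other listing is the whole win set** (`max(Λ₁,Λ₂) = #wins`). -/
theorem endpointPair_listing_eq_wins (hn : 1 ≤ n) (c : ℕ) :
    max (listing n c (endpointPair n) 1) (listing n c (endpointPair n) 2) = wins n c (endpointPair n) := by
  rw [exchangeLaw]
  rcases endpointPair_listing_zero hn c with h | h <;> simp [h]

end Summit.QuantumAdvantage.QuantumAdvantage.Theorems.NamingDial
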